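import Summits.Parity.BatemanHorn.Theorems.DiscMajorantLog.Negative.LoadBearingClauses
import Literature.NumberTheory.LFunctions.RHWave0PNTProofs
import Summits.Parity.BatemanHorn.Theorems.AlmostPrimeZerosExtractionAtZeroAux

/-!
# Crux `DiscMajorantLog` (stmt-Parity-17114) — the `Re z = 0` cut of line `Sketch`:
load-bearing clauses on the RIGHT half-disc

Negative-side theorems (standing disprover `cdisprove-stmt-Parity-17114`, 2026-08-17) for the near leaf
`Summit.Parity.BatemanHorn.Theses.AlmostPrimeZeros.DiscMajorantLog` of route `AlmostPrimeZeros`,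

  `∀ (k,f) BH, ∃ A C x₀, ∀ x ≥ x₀, ∀ z, ‖z − 1‖ ≤ 3 log log x →
     ‖Σ_{n≤x} z^{s_f(n)}‖ ≤ A·x·(log x)^{k(Re z − 1)}·exp(C‖z−1‖ log(‖z−1‖+2))`,

companion of `FalseWithoutPairwise.lean` (p136416) and `LoadBearingClauses.lean` (p140268), where all four
clauses of `IsBatemanHornSystem` were shown load-bearing through the point `z = −1`, i.e. on the LEFT
half-disc.  The lead's registered line `Sketch` cuts the crux at `Re z = 0` into
`stub_rightHalfDiscMajorantLog` (`0 ≤ Re z`) and `stub_leftHalfDiscMajorantLog` (`Re z < 0`).  This file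
and its two companions (`RightHalfIrreducible.lean`, `LeftHalfTwinViolation.lean`) answer, for that cut,
"which hypotheses does EACH half need?".  Here:

* `body_false_of_lower` — ENGINE: a lower bound `c·x/(log x)^β ≤ F x z₀` for all large `x` at ONE point
  `z₀` with `‖z₀ − 1‖ ≤ 2` (inside the disc once `x ≥ 16`) and `β < k(1 − Re z₀)` refutes the majorant
  body restricted to any zone `Q ∋ z₀`.
* RIGHT half-disc (`Q z := 0 ≤ Re z`), PARITY-FREE witnesses at REAL points `0 < t < 1`, where the claim is
  an almost-prime UPPER bound `O_t(x (log x)^{−k(1−t)})`: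
  `stub_rightHalf_false_without_leadingCoeff_pos` (`![−X]`, statistic `0`, `S_x(1/2) = x + 1`),
  `stub_rightHalf_false_without_hasNoFixedPrimeDivisor` (`![C 2]`, statistic `1`, `S_x(1/2) = (x+1)/2`),
  `stub_rightHalf_false_without_pairwise` (`![X, X]`, statistic `2 s(n)`:
  `S_x(1/4) ≥ π(x)/16 ≥ x/(32 log x)` by the prime number theorem, against the claim `O(x (log x)^{−3/2})`).
  (`irreducible`: `RightHalfIrreducible.lean`, witness `X²` at `t = 2` via Selberg–Delange.)
* `stub_rightHalf_not_abs` — on the right half, too, the triangle inequality cannot prove the majorant for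
  any system with `k ≥ 1` (witness `z = i`: `Σ ‖i‖^{s_f(n)} = x + 1` against `O(x (log x)^{−k})`): off the
  real axis the right stub is cancellation between the layers `#{s_f = j}`, not anatomy.

Reading for the provers: the right stub is NOT hypothesis-free "anatomy" — without `leadingCoeff_pos`,
`hasNoFixedPrimeDivisor` or `pairwise_not_associated` its lower-tail content (`0 < t < 1`: upper bounds
for `#{n ≤ x : s_f(n) ≤ j}` of the right order `x (log x)^{−k} (log log x)^j`) is already false.
-/

noncomputable section

namespace Summit.Parity.BatemanHorn.Theorems.DiscMajorantLog.Negative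

open Polynomial Filter Asymptotics
open Literature.NumberTheory.Sieve
open Summit.Parity.BatemanHorn.Theorems.SystemZeroRepulsion.Negative
open Summit.Parity.BatemanHorn.Theorems.AlmostPrimeZerosExtraction (factorization_sum_min_two_of_prime)

/-! ## The engine: one good lower bound at one point of the disc -/

/-- ENGINE.  Let `Q` be a zone of the disc and `z₀ ∈ Q` a point with `‖z₀ − 1‖ ≤ 2` (so `z₀` lies in
`‖z − 1‖ ≤ 3 log log x` for every `x ≥ 16`).  If `F x z₀ ≥ c·x/(log x)^β` for all large `x`, with `c > 0`
and `β < k(1 − Re z₀)`, then the majorant body restricted to `Q` fails for `F`: at `z₀` it would give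
`c (log x)^{k(1 − Re z₀) − β} ≤ A e^{C‖z₀−1‖ log(‖z₀−1‖+2)}` for all large `x`. [folklore] -/
theorem body_false_of_lower {k : ℕ} {F : ℕ → ℂ → ℝ} {Q : ℂ → Prop} {z₀ : ℂ} {β c : ℝ}
    (hz₀ : ‖z₀ - 1‖ ≤ 2) (hQ : Q z₀) (hc : 0 < c) (hβ : β < k * (1 - z₀.re))
    (hlow : ∀ᶠ x : ℕ in atTop, c * (x : ℝ) / (Real.log (x : ℝ)) ^ β ≤ F x z₀) :
    ¬ ∃ A C : ℝ, ∃ x₀ : ℕ, ∀ x : ℕ, x₀ ≤ x → ∀ z : ℂ, ‖z - 1‖ ≤ 3 * Real.log (Real.log (x : ℝ)) →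
      Q z → F x z ≤ A * (x : ℝ) * (Real.log (x : ℝ)) ^ ((k : ℝ) * ((z : ℂ).re - 1)) *
          Real.exp (C * ‖(z : ℂ) - 1‖ * Real.log (‖(z : ℂ) - 1‖ + 2)) := by
  rintro ⟨A, C, x₀, h⟩
  set E : ℝ := Real.exp (C * ‖z₀ - 1‖ * Real.log (‖z₀ - 1‖ + 2)) with hE
  set K : ℝ := A * E with hK
  set δ : ℝ := k * (1 - z₀.re) - β with hδ
  have hδpos : 0 < δ := by rw [hδ]; linarith
  have hT : Tendsto (fun x : ℕ => Real.log (x : ℝ) ^ δ) atTop atTop :=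
    (tendsto_rpow_atTop hδpos).comp (Real.tendsto_log_atTop.comp tendsto_natCast_atTop_atTop)
  obtain ⟨x, hx₀, hx16, hlowx, hbig⟩ :=
    ((eventually_ge_atTop x₀).and ((eventually_ge_atTop 16).and
      (hlow.and (hT.eventually_gt_atTop (K / c))))).exists
  have hx16R : (16 : ℝ) ≤ x := by exact_mod_cast hx16
  have hxpos : (0 : ℝ) < x := by linarith
  obtain ⟨h23, hlogx⟩ := two_le_three_loglog_of_sixteen_le hx16R
  have hz : ‖z₀ - 1‖ ≤ 3 * Real.log (Real.log (x : ℝ)) := hz₀.trans h23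
  have hmain := h x hx₀ z₀ hz hQ
  have hre : (k : ℝ) * (z₀.re - 1) = -(δ + β) := by rw [hδ]; ring
  rw [hre, Real.rpow_neg hlogx.le, Real.rpow_add hlogx, ← hE] at hmain
  have ha : 0 < Real.log (x : ℝ) ^ δ := Real.rpow_pos_of_pos hlogx _
  have hb : 0 < Real.log (x : ℝ) ^ β := Real.rpow_pos_of_pos hlogx _
  have h1 : c * x / Real.log (x : ℝ) ^ β ≤ K * x / (Real.log (x : ℝ) ^ δ * Real.log (x : ℝ) ^ β) := by
    calc c * x / Real.log (x : ℝ) ^ β ≤ F x z₀ := hlowx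
      _ ≤ A * x * (Real.log (x : ℝ) ^ δ * Real.log (x : ℝ) ^ β)⁻¹ * E := hmain
      _ = K * x / (Real.log (x : ℝ) ^ δ * Real.log (x : ℝ) ^ β) := by rw [hK]; ring
  set a : ℝ := Real.log (x : ℝ) ^ δ with ha_def
  set b : ℝ := Real.log (x : ℝ) ^ β with hb_def
  have ha' : a ≠ 0 := ha.ne'
  have hb' : b ≠ 0 := hb.ne'
  have h1' : c * x * a ≤ K * x := by
    have hmul := mul_le_mul_of_nonneg_right h1 (mul_pos ha hb).le
    have e1 : c * x / b * (a * b) = c * x * a := by field_simp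
    have e2 : K * x / (a * b) * (a * b) = K * x := by field_simp
    linarith
  have h2 : c * a ≤ K := by nlinarith
  have h3 : K < a * c := (div_lt_iff₀ hc).1 hbig
  nlinarith

/-! ## Bookkeeping at real points -/

/-- `‖t − 1‖ = 1 − t` for real `0 ≤ t ≤ 1` viewed in `ℂ`. [folklore] -/
theorem norm_ofReal_sub_one {t : ℝ} (ht1 : t ≤ 1) : ‖(t : ℂ) - 1‖ = 1 - t := by
  rw [show (t : ℂ) - 1 = ((t - 1 : ℝ) : ℂ) by push_cast; ring, Complex.norm_real, Real.norm_eq_abs,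
    abs_of_nonpos (by linarith)]
  ring

/-- A sum of real powers `t^{e n}`, `t ≥ 0`, computed in `ℂ`, has norm equal to the real sum. [folklore] -/
theorem norm_sum_ofReal_pow (s : Finset ℕ) (e : ℕ → ℕ) {t : ℝ} (ht : 0 ≤ t) :
    ‖∑ n ∈ s, (t : ℂ) ^ (e n)‖ = ∑ n ∈ s, t ^ (e n) := by
  rw [show (∑ n ∈ s, (t : ℂ) ^ (e n)) = ((∑ n ∈ s, t ^ (e n) : ℝ) : ℂ) by push_cast; rfl,
    Complex.norm_real, Real.norm_of_nonneg (Finset.sum_nonneg fun n _ => pow_nonneg ht _)]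

/-- `π(x)` counts the primes in `range (x+1)`. [folklore] -/
theorem card_filter_prime_range (x : ℕ) :
    ((Finset.range (x + 1)).filter Nat.Prime).card = Nat.primeCounting x := by
  rw [Nat.primeCounting, Nat.primeCounting', Nat.count_eq_card_filter_range]

/-- Prime number theorem, lower half, along `ℕ`: `π(x) ≥ x/(2 log x)` for all large `x`
(`Literature.NumberTheory.LFunctions.primeCounting_isEquivalent_holds`). [folklore] -/
theorem eventually_half_le_primeCounting :
    ∀ᶠ x : ℕ in atTop, (1 / 2 : ℝ) * ((x : ℝ) / Real.log (x : ℝ)) ≤ (Nat.primeCounting x : ℝ) := by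
  have hPNT : (fun y : ℝ => (Nat.primeCounting ⌊y⌋₊ : ℝ)) ~[atTop] fun y => y / Real.log y :=
    Literature.NumberTheory.LFunctions.primeCounting_isEquivalent_holds
  have h := (hPNT.comp_tendsto tendsto_natCast_atTop_atTop).isLittleO.bound (by norm_num : (0 : ℝ) < 1 / 2)
  filter_upwards [h, eventually_gt_atTop 1] with x hx hx1
  have hx1R : (1 : ℝ) < x := by exact_mod_cast hx1
  have hpos : 0 < (x : ℝ) / Real.log x := div_pos (by linarith) (Real.log_pos hx1R)
  simp only [Function.comp, Pi.sub_apply, Nat.floor_natCast, Real.norm_eq_abs, abs_of_pos hpos] at hx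
  have := (abs_le.mp hx).1
  linarith

/-! ## RIGHT half-disc: `leadingCoeff_pos` is load-bearing (witness `−X`, `t = 1/2`) -/

/-- DROP `leadingCoeff_pos` ⇒ the RIGHT-half-disc stub `stub_rightHalfDiscMajorantLog` of line `Sketch`
is FALSE (members still non-constant): witness `k = 1`, `f = ![−X]`, whose statistic vanishes
(`(−n).toNat = 0`), so `S_x(z) = x + 1` for every `z`; at the real point `z = 1/2` (`0 ≤ Re z`,
`‖z − 1‖ = 1/2`) the claim is `x + 1 ≤ A e^{(C/2) log(5/2)} x (log x)^{−1/2}`. [folklore] -/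
theorem stub_rightHalf_false_without_leadingCoeff_pos :
    ¬ ∀ (k : ℕ) (f : Fin k → ℤ[X]), (∀ i, 0 < (f i).natDegree) → (∀ i, Irreducible (f i)) →
      (Pairwise fun i j => ¬Associated (f i) (f j)) → HasNoFixedPrimeDivisor f →
      ∃ A C : ℝ, ∃ x₀ : ℕ, ∀ x : ℕ, x₀ ≤ x → ∀ z : ℂ, ‖z - 1‖ ≤ 3 * Real.log (Real.log (x : ℝ)) →
        0 ≤ z.re →
        ‖(∑ n ∈ Finset.range (x + 1), (z : ℂ) ^ (∑ i, (((f i).eval (n : ℤ)).toNat.factorization.sum fun _ v => min v 2)))‖ ≤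
          A * (x : ℝ) * (Real.log (x : ℝ)) ^ ((k : ℝ) * ((z : ℂ).re - 1)) *
            Real.exp (C * ‖(z : ℂ) - 1‖ * Real.log (‖(z : ℂ) - 1‖ + 2)) := by
  intro h
  have hdeg : ∀ i : Fin 1, 0 < ((![-X] : Fin 1 → ℤ[X]) i).natDegree := by
    intro i; fin_cases i; simp
  refine body_false_of_lower (k := 1) (Q := fun z : ℂ => 0 ≤ z.re) (z₀ := ((1 / 2 : ℝ) : ℂ)) (β := 0) (c := 1)
    (F := fun (x : ℕ) (z : ℂ) => ‖∑ n ∈ Finset.range (x + 1), (z : ℂ) ^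
      (∑ i, ((((![-X] : Fin 1 → ℤ[X]) i).eval (n : ℤ)).toNat.factorization.sum fun _ v => min v 2))‖)
    ?_ ?_ one_pos ?_ ?_ (h 1 ![-X] hdeg negX_irreducible negX_pairwise negX_hasNoFixedPrimeDivisor)
  · rw [norm_ofReal_sub_one (by norm_num)]; norm_num
  · simp only [Complex.ofReal_re]; norm_num
  · simp only [Complex.ofReal_re, Nat.cast_one]; norm_num
  · refine Eventually.of_forall fun x => ?_
    have hterm : ∀ n ∈ Finset.range (x + 1), (((1 / 2 : ℝ) : ℂ)) ^
        (∑ i : Fin 1, ((((![-X] : Fin 1 → ℤ[X]) i).eval (n : ℤ)).toNat.factorization.sum fun _ v => min v 2)) = 1 := by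
      intro n _
      simp
    simp only [Real.rpow_zero, div_one, one_mul]
    rw [Finset.sum_congr rfl hterm, norm_sum_range_const_one]
    linarith

/-! ## RIGHT half-disc: `hasNoFixedPrimeDivisor` is load-bearing (witness `C 2`, `t = 1/2`) -/

/-- DROP `hasNoFixedPrimeDivisor` ⇒ the RIGHT-half-disc stub is FALSE: witness `k = 1`, `f = ![C 2]`
(statistic identically `1`), `S_x(1/2) = (x+1)/2` against `A e^{(C/2) log(5/2)} x (log x)^{−1/2}`.
(As on the full disc, only CONSTANT witnesses are available: for non-constant systems with a fixed prime
divisor, e.g. `(X, X+1)`, no violation is visible even heuristically.) [folklore] -/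
theorem stub_rightHalf_false_without_hasNoFixedPrimeDivisor :
    ¬ ∀ (k : ℕ) (f : Fin k → ℤ[X]), (∀ i, Irreducible (f i)) → (∀ i, 0 < (f i).leadingCoeff) →
      (Pairwise fun i j => ¬Associated (f i) (f j)) →
      ∃ A C : ℝ, ∃ x₀ : ℕ, ∀ x : ℕ, x₀ ≤ x → ∀ z : ℂ, ‖z - 1‖ ≤ 3 * Real.log (Real.log (x : ℝ)) →
        0 ≤ z.re →
        ‖(∑ n ∈ Finset.range (x + 1), (z : ℂ) ^ (∑ i, (((f i).eval (n : ℤ)).toNat.factorization.sum fun _ v => min v 2)))‖ ≤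
          A * (x : ℝ) * (Real.log (x : ℝ)) ^ ((k : ℝ) * ((z : ℂ).re - 1)) *
            Real.exp (C * ‖(z : ℂ) - 1‖ * Real.log (‖(z : ℂ) - 1‖ + 2)) := by
  intro h
  have h2 : ((2 : ℕ)).factorization.sum (fun _ v => min v 2) = 1 := factorization_sum_min_two_of_prime Nat.prime_two
  refine body_false_of_lower (k := 1) (Q := fun z : ℂ => 0 ≤ z.re) (z₀ := ((1 / 2 : ℝ) : ℂ)) (β := 0)
    (c := 1 / 2)
    (F := fun (x : ℕ) (z : ℂ) => ‖∑ n ∈ Finset.range (x + 1), (z : ℂ) ^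
      (∑ i, ((((![C 2] : Fin 1 → ℤ[X]) i).eval (n : ℤ)).toNat.factorization.sum fun _ v => min v 2))‖)
    ?_ ?_ (by norm_num) ?_ ?_ (h 1 ![C 2] constTwo_irreducible constTwo_leadingCoeff_pos constTwo_pairwise)
  · rw [norm_ofReal_sub_one (by norm_num)]; norm_num
  · simp only [Complex.ofReal_re]; norm_num
  · simp only [Complex.ofReal_re, Nat.cast_one]; norm_num
  · refine Eventually.of_forall fun x => ?_
    have hterm : ∀ n ∈ Finset.range (x + 1), (((1 / 2 : ℝ) : ℂ)) ^
        (∑ i : Fin 1, ((((![C 2] : Fin 1 → ℤ[X]) i).eval (n : ℤ)).toNat.factorization.sum fun _ v => min v 2)) =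
          (((1 / 2 : ℝ) : ℂ)) ^ 1 := by
      intro n _
      simp [h2]
    simp only [Real.rpow_zero, div_one]
    rw [Finset.sum_congr rfl hterm, norm_sum_ofReal_pow _ _ (by norm_num)]
    simp only [pow_one, Finset.sum_const, Finset.card_range, nsmul_eq_mul]
    push_cast
    linarith

/-! ## RIGHT half-disc: `pairwise_not_associated` is load-bearing (witness `(X, X)`, `t = 1/4`, PNT) -/

/-- DROP `pairwise_not_associated` ⇒ the RIGHT-half-disc stub is FALSE: witness `k = 2`, `f = ![X, X]`
(statistic `2 s(n)`).  At the real point `t = 1/4` every term is `≥ 0` and each prime `p ≤ x`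
contributes `t² = 1/16`, so `S_x(1/4) ≥ π(x)/16 ≥ x/(32 log x)` for large `x` (prime number theorem),
against the claim `A e^{(3C/4) log(11/4)} x (log x)^{2(1/4 − 1)} = O(x (log x)^{−3/2})`.  Mechanism: a
duplicated member doubles `k` in the claimed lower-tail exponent `(log x)^{−k(1−t)}` without thinning the
primes along `f`. [folklore] -/
theorem stub_rightHalf_false_without_pairwise :
    ¬ ∀ (k : ℕ) (f : Fin k → ℤ[X]), (∀ i, Irreducible (f i)) → (∀ i, 0 < (f i).leadingCoeff) →
      HasNoFixedPrimeDivisor f →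
      ∃ A C : ℝ, ∃ x₀ : ℕ, ∀ x : ℕ, x₀ ≤ x → ∀ z : ℂ, ‖z - 1‖ ≤ 3 * Real.log (Real.log (x : ℝ)) →
        0 ≤ z.re →
        ‖(∑ n ∈ Finset.range (x + 1), (z : ℂ) ^ (∑ i, (((f i).eval (n : ℤ)).toNat.factorization.sum fun _ v => min v 2)))‖ ≤
          A * (x : ℝ) * (Real.log (x : ℝ)) ^ ((k : ℝ) * ((z : ℂ).re - 1)) *
            Real.exp (C * ‖(z : ℂ) - 1‖ * Real.log (‖(z : ℂ) - 1‖ + 2)) := by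
  intro h
  refine body_false_of_lower (k := 2) (Q := fun z : ℂ => 0 ≤ z.re) (z₀ := ((1 / 4 : ℝ) : ℂ)) (β := 1)
    (c := 1 / 32)
    (F := fun (x : ℕ) (z : ℂ) => ‖∑ n ∈ Finset.range (x + 1), (z : ℂ) ^
      (∑ i, ((((![X, X] : Fin 2 → ℤ[X]) i).eval (n : ℤ)).toNat.factorization.sum fun _ v => min v 2))‖)
    ?_ ?_ (by norm_num) ?_ ?_ (h 2 ![X, X] pairXX_irreducible pairXX_leadingCoeff_pos pairXX_hasNoFixedPrimeDivisor)
  · rw [norm_ofReal_sub_one (by norm_num)]; norm_num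
  · simp only [Complex.ofReal_re]; norm_num
  · simp only [Complex.ofReal_re, Nat.cast_ofNat]; norm_num
  · filter_upwards [eventually_half_le_primeCounting] with x hx
    -- every term is a real power of `1/4`; primes contribute `(1/4)²`
    have hterm : ∀ n ∈ Finset.range (x + 1), (((1 / 4 : ℝ) : ℂ)) ^
        (∑ i : Fin 2, ((((![X, X] : Fin 2 → ℤ[X]) i).eval (n : ℤ)).toNat.factorization.sum fun _ v => min v 2)) =
          (((1 / 4 : ℝ) : ℂ)) ^ (2 * (n.factorization.sum fun _ v => min v 2)) := by
      intro n _
      rw [pairXX_exponent]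
    simp only [Real.rpow_one]
    rw [Finset.sum_congr rfl hterm, norm_sum_ofReal_pow _ _ (by norm_num)]
    have hsub : (Finset.range (x + 1)).filter Nat.Prime ⊆ Finset.range (x + 1) := Finset.filter_subset _ _
    have hprimes : ∑ n ∈ (Finset.range (x + 1)).filter Nat.Prime,
        (1 / 4 : ℝ) ^ (2 * (n.factorization.sum fun _ v => min v 2)) = (Nat.primeCounting x : ℝ) * (1 / 16) := by
      rw [Finset.sum_congr rfl (g := fun _ => (1 / 16 : ℝ)), Finset.sum_const, nsmul_eq_mul,
        card_filter_prime_range]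
      intro p hp
      rw [factorization_sum_min_two_of_prime (Finset.mem_filter.mp hp).2]; norm_num
    have hle : ∑ n ∈ (Finset.range (x + 1)).filter Nat.Prime,
        (1 / 4 : ℝ) ^ (2 * (n.factorization.sum fun _ v => min v 2)) ≤
          ∑ n ∈ Finset.range (x + 1), (1 / 4 : ℝ) ^ (2 * (n.factorization.sum fun _ v => min v 2)) :=
      Finset.sum_le_sum_of_subset_of_nonneg hsub fun n _ _ => pow_nonneg (by norm_num) _
    rw [hprimes] at hle
    have : (1 / 32 : ℝ) * x / Real.log x = (1 / 2 * ((x : ℝ) / Real.log x)) * (1 / 16) := by ring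
    rw [this]
    nlinarith

/-! ## RIGHT half-disc: no proof through the triangle inequality (any system, `k ≥ 1`, witness `z = i`) -/

/-- On the RIGHT half-disc too, the majorant cannot be proved through the triangle inequality
(`‖Σ z^{s_f(n)}‖ ≤ Σ ‖z‖^{s_f(n)}`), for ANY system with `k ≥ 1`: at `z = i` (`Re z = 0`,
`‖z − 1‖ = √2`) one has `Σ_{n≤x} ‖i‖^{s_f(n)} = x + 1` against the claim `O(x (log x)^{−k})`.  So off the
real axis the right stub asks for CANCELLATION between the layers `#{n ≤ x : s_f(n) = j}`, not for
anatomy upper bounds of those layers (companion of `not_discMajorantLog_abs`, p140363, whose witness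
`z = −1` lies on the left half). [folklore] -/
theorem stub_rightHalf_not_abs {k : ℕ} (hk : 1 ≤ k) (f : Fin k → ℤ[X]) :
    ¬ ∃ A C : ℝ, ∃ x₀ : ℕ, ∀ x : ℕ, x₀ ≤ x → ∀ z : ℂ, ‖z - 1‖ ≤ 3 * Real.log (Real.log (x : ℝ)) →
      0 ≤ z.re →
      (∑ n ∈ Finset.range (x + 1), ‖z‖ ^ (∑ i, (((f i).eval (n : ℤ)).toNat.factorization.sum fun _ v => min v 2))) ≤
        A * (x : ℝ) * (Real.log (x : ℝ)) ^ ((k : ℝ) * ((z : ℂ).re - 1)) *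
          Real.exp (C * ‖(z : ℂ) - 1‖ * Real.log (‖(z : ℂ) - 1‖ + 2)) := by
  refine body_false_of_lower (k := k) (Q := fun z : ℂ => 0 ≤ z.re) (z₀ := Complex.I) (β := 0) (c := 1)
    (F := fun (x : ℕ) (z : ℂ) => ∑ n ∈ Finset.range (x + 1),
      ‖z‖ ^ (∑ i, (((f i).eval (n : ℤ)).toNat.factorization.sum fun _ v => min v 2)))
    ?_ ?_ one_pos ?_ ?_
  · calc ‖Complex.I - 1‖ ≤ |(Complex.I - 1).re| + |(Complex.I - 1).im| := Complex.norm_le_abs_re_add_abs_im _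
      _ = 2 := by simp; norm_num
  · simp
  · have hk1 : (1 : ℝ) ≤ k := by exact_mod_cast hk
    simp only [Complex.I_re, sub_zero, mul_one]
    linarith
  · refine Eventually.of_forall fun x => ?_
    simp only [Complex.norm_I, one_pow, Finset.sum_const, Finset.card_range, nsmul_eq_mul, mul_one,
      Real.rpow_zero, div_one, one_mul]
    push_cast
    linarith

end Summit.Parity.BatemanHorn.Theorems.DiscMajorantLog.Negative
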